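import Mathlib.LinearAlgebra.Matrix.NonsingularInverse
import Summits.RiemannHypothesis.RiemannHypothesis.Theorems.HandoffLoewnerKernel
import Mathlib.Algebra.Order.BigOperators.Ring.Finset
import Mathlib.Analysis.SpecialFunctions.Pow.Real

/-!
# Handoff (rh-explicit, prove-1), Route E: the least-eigenvalue bound `λ_min(C D Cᵀ) ≥ 1/Ψ` of
ATTEMPT-14 LEMMA C (a) — the Frobenius-norm-of-the-inverse bound, in quadratic-form language

For an invertible real matrix `C` and a positive diagonal `D = diag(d)`, the Gram-type matrix
`M = C D Cᵀ` satisfies, for every vector `v`,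

  `v ⬝ v ≤ Ψ · (v ⬝ M v)`,   `Ψ := ∑_{j,i} (C⁻¹)_{ij}² / d_i = ‖D^{-1/2} C⁻¹‖_F²`,

i.e. `λ_min(M) ≥ 1/Ψ` (handoff/prove-1 ATTEMPT-14 §1.6, LEMMA C (a), where `C` is the square Cauchy
matrix `(1/(x_j + y_i))` of the selected Bessel zeros, `d_i = 2y_i`, and `Ψ = Ψ_K` is then explicit by
the Cauchy inverse formula — tree: `Literature.LinearAlgebra.Matrix.det_cauchyMatrix`). Proof: with
`u := Cᵀ v` one has `v = (C⁻¹)ᵀ u`, so `v ⬝ v = ∑_j (∑_i (C⁻¹)_{ij} u_i)²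
≤ ∑_j (∑_i (C⁻¹)_{ij}²/d_i)(∑_i d_i u_i²)` (Cauchy–Schwarz with weights) and `∑_i d_i u_i² = v ⬝ M v`.
Nothing here bears on RH (finite-dimensional real linear algebra). [elementary]
-/

set_option linter.dupNamespace false

noncomputable section

open Matrix Finset

namespace Summit.RiemannHypothesis.RiemannHypothesis.Theorems.HandoffTraceBound

variable {n : Type*} [Fintype n] [DecidableEq n]

omit [Fintype n] [DecidableEq n] in
/-- Weighted Cauchy–Schwarz: `(∑ a_i b_i)² ≤ (∑ a_i²/d_i)·(∑ d_i b_i²)` for positive weights `d_i`.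
[elementary] -/
theorem sq_sum_mul_le_weighted (s : Finset n) (a b d : n → ℝ) (hd : ∀ i ∈ s, 0 < d i) :
    (∑ i ∈ s, a i * b i) ^ 2 ≤ (∑ i ∈ s, a i ^ 2 / d i) * (∑ i ∈ s, d i * b i ^ 2) := by
  have key := Finset.sum_mul_sq_le_sq_mul_sq s (fun i => a i / Real.sqrt (d i)) (fun i => Real.sqrt (d i) * b i)
  have h1 : ∀ i ∈ s, a i / Real.sqrt (d i) * (Real.sqrt (d i) * b i) = a i * b i := by
    intro i hi
    have hs : Real.sqrt (d i) ≠ 0 := (Real.sqrt_pos.2 (hd i hi)).ne'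
    field_simp
  have h2 : ∀ i ∈ s, (a i / Real.sqrt (d i)) ^ 2 = a i ^ 2 / d i := by
    intro i hi
    rw [div_pow, Real.sq_sqrt (hd i hi).le]
  have h3 : ∀ i ∈ s, (Real.sqrt (d i) * b i) ^ 2 = d i * b i ^ 2 := by
    intro i hi
    rw [mul_pow, Real.sq_sqrt (hd i hi).le]
  rw [Finset.sum_congr rfl h1, Finset.sum_congr rfl h2, Finset.sum_congr rfl h3] at key
  exact key

omit [DecidableEq n] in
/-- Frobenius-type bound with weights: for any real matrix `A`, vector `u` and positive weights `d`,
`(A u) ⬝ (A u) ≤ (∑_{j,i} A_{ji}²/d_i) · ∑_i d_i u_i²`. [elementary] -/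
theorem mulVec_dotProduct_self_le (A : Matrix n n ℝ) (u d : n → ℝ) (hd : ∀ i, 0 < d i) :
    (A *ᵥ u) ⬝ᵥ (A *ᵥ u) ≤ (∑ j, ∑ i, A j i ^ 2 / d i) * (∑ i, d i * u i ^ 2) := by
  simp only [dotProduct, mulVec]
  rw [Finset.sum_mul]
  refine Finset.sum_le_sum fun j _ => ?_
  have := sq_sum_mul_le_weighted Finset.univ (fun i => A j i) u d (fun i _ => hd i)
  rw [sq] at this
  exact this

/-- **`λ_min(C D Cᵀ) ≥ 1/Ψ`, quadratic-form version** (ATTEMPT-14 LEMMA C (a)): for an invertible real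
matrix `C`, positive weights `d` and every vector `v`,
`v ⬝ v ≤ (∑_{i,j} (C⁻¹)_{ij}²/d_i) · v ⬝ ((C * diagonal d * Cᵀ) v)` (the weight `d_i` goes with the ROW index of `C⁻¹`:
`Ψ = ‖diag(d)^{-1/2} C⁻¹‖_F²`). [elementary] -/
theorem dotProduct_self_le_psi_mul (C : Matrix n n ℝ) (hC : IsUnit C.det) (d : n → ℝ)
    (hd : ∀ i, 0 < d i) (v : n → ℝ) :
    v ⬝ᵥ v ≤ (∑ i, ∑ j, (C⁻¹) i j ^ 2 / d i) * (v ⬝ᵥ ((C * diagonal d * Cᵀ) *ᵥ v)) := by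
  -- u := Cᵀ v and v = (C⁻¹)ᵀ u = C⁻¹ᵀ (Cᵀ v)
  set u : n → ℝ := Cᵀ *ᵥ v with hu
  have hCt : IsUnit Cᵀ.det := by rwa [det_transpose]
  have hv : v = (C⁻¹)ᵀ *ᵥ u := by
    rw [hu, mulVec_mulVec, ← transpose_mul, mul_nonsing_inv _ hC, transpose_one, one_mulVec]
  -- the quadratic form: v ⬝ (C D Cᵀ v) = ∑ d_i u_i²
  have hq : v ⬝ᵥ ((C * diagonal d * Cᵀ) *ᵥ v) = ∑ i, d i * u i ^ 2 := by
    rw [← mulVec_mulVec, ← mulVec_mulVec, dotProduct_mulVec, ← hu]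
    have : v ᵥ* C = u := by rw [hu, ← vecMul_transpose, transpose_transpose]
    rw [this]
    simp only [dotProduct, mulVec_diagonal]
    refine Finset.sum_congr rfl fun i _ => ?_
    ring
  rw [hq]
  have key := mulVec_dotProduct_self_le (C⁻¹)ᵀ u d hd
  rw [← hv] at key
  -- (C⁻¹)ᵀ j i = C⁻¹ i j : reindex the double sum
  have hsum : (∑ j, ∑ i, (C⁻¹)ᵀ j i ^ 2 / d i) = ∑ i, ∑ j, (C⁻¹) i j ^ 2 / d i := by
    simp only [transpose_apply]
    rw [Finset.sum_comm]
  rw [hsum] at key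
  exact key

/-- The Loewner/Cauchy quadratic form in matrix language: with `Cm j k := 1/(t k + x j)` and weights
`d k`, `∑_j ∑_l c_j c_l ∑_k d_k/((t_k + x_j)(t_k + x_l)) = c ⬝ ((Cm * diagonal d * Cmᵀ) c)`
(both equal `∑_k d_k (∑_j c_j/(t_k + x_j))²`, cf. `HandoffLoewnerKernel.loewnerKernel_quadratic`). [elementary] -/
theorem cauchy_quadratic_eq_dotProduct (x t d c : n → ℝ) (h : ∀ k j, t k + x j ≠ 0) :
    ∑ j, ∑ l, c j * c l * (∑ k, d k / ((t k + x j) * (t k + x l)))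
      = c ⬝ᵥ (((Matrix.of fun j k => 1 / (t k + x j)) * diagonal d
          * (Matrix.of fun j k => 1 / (t k + x j) : Matrix n n ℝ)ᵀ) *ᵥ c) := by
  set Cm : Matrix n n ℝ := Matrix.of fun j k => 1 / (t k + x j) with hCm
  have hu : ∀ k, (Cmᵀ *ᵥ c) k = ∑ j, c j / (t k + x j) := by
    intro k
    simp only [mulVec, dotProduct, transpose_apply, hCm, Matrix.of_apply, one_div_mul_eq_div]
  have hL : (∑ j, ∑ l, c j * c l * ∑ k, d k / ((t k + x j) * (t k + x l)))
      = ∑ k, d k * (∑ j, c j / (t k + x j)) ^ 2 := by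
    calc (∑ j, ∑ l, c j * c l * ∑ k, d k / ((t k + x j) * (t k + x l)))
        = ∑ j, ∑ l, ∑ k, d k * ((c j / (t k + x j)) * (c l / (t k + x l))) := by
          refine Finset.sum_congr rfl fun j _ => Finset.sum_congr rfl fun l _ => ?_
          rw [Finset.mul_sum]
          refine Finset.sum_congr rfl fun k _ => ?_
          have hj := h k j
          have hl := h k l
          field_simp
      _ = ∑ j, ∑ k, ∑ l, d k * ((c j / (t k + x j)) * (c l / (t k + x l))) := by
          refine Finset.sum_congr rfl fun j _ => ?_
          rw [Finset.sum_comm]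
      _ = ∑ k, ∑ j, ∑ l, d k * ((c j / (t k + x j)) * (c l / (t k + x l))) := by
          rw [Finset.sum_comm]
      _ = ∑ k, d k * (∑ j, c j / (t k + x j)) ^ 2 := by
          refine Finset.sum_congr rfl fun k _ => ?_
          rw [sq, Finset.sum_mul_sum, Finset.mul_sum]
          refine Finset.sum_congr rfl fun j _ => ?_
          rw [Finset.mul_sum]
  have hR : c ⬝ᵥ ((Cm * diagonal d * Cmᵀ) *ᵥ c) = ∑ k, d k * (∑ j, c j / (t k + x j)) ^ 2 := by
    rw [← mulVec_mulVec, ← mulVec_mulVec, dotProduct_mulVec]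
    have h1 : c ᵥ* Cm = Cmᵀ *ᵥ c := by rw [← vecMul_transpose, transpose_transpose]
    rw [h1]
    simp only [dotProduct, mulVec_diagonal, hu]
    refine Finset.sum_congr rfl fun k _ => ?_
    ring
  rw [hL, hR]

/-- **LEMMA C (a) of ATTEMPT-14 in kernel form.** For nodes `x_j`, poles `t_k` and weights `d_k > 0`
indexed by one finite type, with all `t_k + x_j ≠ 0` and the Cauchy matrix `Cm = (1/(t_k + x_j))_{j,k}`
invertible, the Loewner/Cauchy quadratic form dominates `(c ⬝ c)/Ψ` with
`Ψ = ∑_{i,j} (Cm⁻¹)_{ij}²/d_i` — i.e. `λ_min(Cm·diag(d)·Cmᵀ) ≥ 1/Ψ`. (With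
`HandoffLoewnerKernel.loewnerKernel_quadratic_mono` one passes from all poles of the Pick function to the
`m` selected ones.) [elementary] -/
theorem cauchy_quadratic_ge (x t d : n → ℝ) (hd : ∀ k, 0 < d k) (h : ∀ k j, t k + x j ≠ 0)
    (hC : IsUnit (Matrix.of fun j k => 1 / (t k + x j) : Matrix n n ℝ).det) (c : n → ℝ) :
    c ⬝ᵥ c ≤ (∑ i, ∑ j, ((Matrix.of fun j k => 1 / (t k + x j) : Matrix n n ℝ)⁻¹) i j ^ 2 / d i)
      * ∑ j, ∑ l, c j * c l * (∑ k, d k / ((t k + x j) * (t k + x l))) := by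
  rw [cauchy_quadratic_eq_dotProduct x t d c h]
  exact dotProduct_self_le_psi_mul _ hC d hd c

/-- **LEMMA C (a) assembled** (ATTEMPT-14 §1.6): the Loewner quadratic form of the FULL Pick partial
fraction (poles `t i`, weights `w i`, `i ∈ s`, `w i · t i ≥ 0`) at nodes `x : n → ℝ` dominates `(c ⬝ c)/Ψ_K`
for every selection `e : n ↪ ι` of `|n|` poles inside `s` with positive weights and invertible square Cauchy
matrix `(1/(t (e k) + x j))_{j,k}`, where `Ψ_K = ∑_{i,j} (C⁻¹)_{ij}²/(w (e i) t (e i))`: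
`λ_min(L[g]) ≥ λ_min(𝒞_K D_K 𝒞_Kᵀ) ≥ 1/Ψ_K` in quadratic-form language
(`HandoffLoewnerKernel.loewnerKernel_quadratic_mono` + `cauchy_quadratic_ge`). [elementary] -/
theorem loewner_quadratic_ge {ι : Type*} (s : Finset ι) (w t : ι → ℝ) (x : n → ℝ) (e : n ↪ ι)
    (he : ∀ k, e k ∈ s) (h : ∀ i ∈ s, ∀ j, t i + x j ≠ 0) (hwt : ∀ i ∈ s, 0 ≤ w i * t i)
    (hpos : ∀ k, 0 < w (e k) * t (e k))
    (hC : IsUnit (Matrix.of fun j k => 1 / (t (e k) + x j) : Matrix n n ℝ).det) (c : n → ℝ) :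
    c ⬝ᵥ c ≤ (∑ i, ∑ j, ((Matrix.of fun j k => 1 / (t (e k) + x j) : Matrix n n ℝ)⁻¹) i j ^ 2
        / (w (e i) * t (e i)))
      * ∑ j, ∑ l, c j * c l * (∑ i ∈ s, w i * t i / ((t i + x j) * (t i + x l))) := by
  -- the selected poles as a sub-finset of `s`
  set s' : Finset ι := Finset.univ.map e with hs'
  have hss : s' ⊆ s := by
    intro i hi
    rw [hs', Finset.mem_map] at hi
    obtain ⟨k, _, rfl⟩ := hi
    exact he k
  -- monotonicity in the pole set (tree: HandoffLoewnerKernel)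
  have hmono := HandoffLoewnerKernel.loewnerKernel_quadratic_mono Finset.univ c x hss w t
    (fun i hi j _ => h i hi j) hwt
  -- the sub-kernel over `s'` in `Fintype` form
  have hsub : ∀ j l, (∑ i ∈ s', w i * t i / ((t i + x j) * (t i + x l)))
      = ∑ k, (w (e k) * t (e k)) / ((t (e k) + x j) * (t (e k) + x l)) := by
    intro j l
    rw [hs', Finset.sum_map]
  simp only [hsub] at hmono
  -- the Cauchy bound for the selected poles
  have hsel := cauchy_quadratic_ge x (fun k => t (e k)) (fun k => w (e k) * t (e k)) hpos
    (fun k j => h (e k) (he k) j) hC c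
  have hΨ : 0 ≤ ∑ i, ∑ j, ((Matrix.of fun j k => 1 / (t (e k) + x j) : Matrix n n ℝ)⁻¹) i j ^ 2
      / (w (e i) * t (e i)) :=
    Finset.sum_nonneg fun i _ => Finset.sum_nonneg fun j _ => div_nonneg (sq_nonneg _) (hpos i).le
  exact hsel.trans (mul_le_mul_of_nonneg_left hmono hΨ)

end Summit.RiemannHypothesis.RiemannHypothesis.Theorems.HandoffTraceBound

end
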